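import Summits.Ventures.YMGap.Thresholds.LatticeBakryEmeryL2
import Mathlib.Analysis.InnerProductSpace.ProdL2
import HarnessLib

/-!
# Venture YMGap — static exponential clustering, Part II-a:
# the Sobolev space `H¹(σ^{⊗E})` as a closed subspace of `L² × (L²)^{E × frame}`

HONEST FRAMING: venture file (cell `pub-ymgap`, track (a), seat lit-1). Functional-analytic
plumbing for the static (semigroup-free) proof of Shen–Zhu–Zhu's mass-gap step
(`shenZhuZhu_massGap_transfer`): Part II supplies approximate solutions of the Poisson equation
`L_S u = g - ⟨g⟩` whose residuals are small in the Dirichlet norm (`H¹`), not only in `L²` — the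
regularity-free substitute for the exact Poisson/Witten-Laplacian solution of Helffer–Sjöstrand.
No physics and no number in this file.

Construction (all on the compact group `SU(N)^E` with product Haar measure `σ^{⊗E}` of
`LatticeBakryEmeryIntegration`): the Hilbert space `𝓗 = L²(σ^{⊗E}) × ∏_{(e,α)} L²(σ^{⊗E})`
(`HSp`, Mathlib's `WithLp 2` product and `PiLp 2`), the map `J F = (F, (D_{(e,α)}F)_{(e,α)})` on
smooth ambient functions (`sobJ`; `⟪J F, J G⟫ = ∫ FG + ∫ Γ(F,G)`, `inner_sobJ_sobJ`), the polynomial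
subspaces `J(𝒫_n)` (`VSob`) and their closure `H¹` (`HOne`). The two structural facts about `H¹`
(weak gradients; smooth functions belong to `H¹`) are in `SharpClusteringWeakGrad`.

## References

* B. Helffer, J. Funct. Anal. 155 (1998) 571–586 (the role of the Witten Laplacian / Poisson
  equation in correlation decay).
* Venture files `LatticeBakryEmery{Polynomials,Integration,L2}.lean` (seat p2).
-/

noncomputable section

open scoped Matrix ComplexConjugate BigOperators Matrix.Norms.Frobenius ContDiff Topology InnerProductSpace
open Matrix Complex Finset MeasureTheory Filter
open Literature.MathematicalPhysics.QuantumFieldTheory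

namespace Summit.Ventures.YMGap

namespace SharpClustering

open LatticeBakryEmery

universe u

variable {ι : Type u} [Fintype ι] [DecidableEq ι] {N : ℕ}

/-! ### The product Hilbert space and the map `J` -/

variable (ι N) in
/-- The Hilbert space `𝓗 = L²(σ^{⊗E}) × ∏_{(e,α)} L²(σ^{⊗E})` housing pairs (function, frame
gradient). -/
abbrev HSp : Type u :=
  WithLp 2 (Lp ℝ 2 (haarPi ι N) × PiLp 2 (fun _ : BIdx ι N => Lp ℝ 2 (haarPi ι N)))

/-- Constructor of elements of `𝓗` from a function component and a family of gradient components. -/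
def hmk (x : Lp ℝ 2 (haarPi ι N)) (y : BIdx ι N → Lp ℝ 2 (haarPi ι N)) : HSp ι N :=
  WithLp.toLp 2 (x, WithLp.toLp 2 y)

omit [DecidableEq ι] in
/-- The function component of `hmk x y` is `x`. -/
@[simp] theorem hmk_fst (x : Lp ℝ 2 (haarPi ι N)) (y : BIdx ι N → Lp ℝ 2 (haarPi ι N)) : (hmk x y).fst = x := rfl

omit [DecidableEq ι] in
/-- The `a`-th gradient component of `hmk x y` is `y a`. -/
@[simp] theorem hmk_snd_apply (x : Lp ℝ 2 (haarPi ι N)) (y : BIdx ι N → Lp ℝ 2 (haarPi ι N)) (a : BIdx ι N) :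
    (hmk x y).snd a = y a := rfl

omit [DecidableEq ι] in
/-- The inner product of `𝓗` in components. -/
theorem inner_HSp (z z' : HSp ι N) : ⟪z, z'⟫_ℝ = ⟪z.fst, z'.fst⟫_ℝ + ∑ a, ⟪z.snd a, z'.snd a⟫_ℝ := by
  rw [WithLp.prod_inner_apply, PiLp.inner_apply]
  rfl

omit [DecidableEq ι] in
/-- `hmk` is compatible with subtraction. -/
theorem hmk_sub (x x' : Lp ℝ 2 (haarPi ι N)) (y y' : BIdx ι N → Lp ℝ 2 (haarPi ι N)) :
    hmk x y - hmk x' y' = hmk (x - x') (y - y') := rfl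

omit [DecidableEq ι] in
/-- `hmk` is compatible with addition. -/
theorem hmk_add (x x' : Lp ℝ 2 (haarPi ι N)) (y y' : BIdx ι N → Lp ℝ 2 (haarPi ι N)) :
    hmk x y + hmk x' y' = hmk (x + x') (y + y') := rfl

omit [DecidableEq ι] in
/-- `hmk` is compatible with scalar multiplication. -/
theorem hmk_smul (r : ℝ) (x : Lp ℝ 2 (haarPi ι N)) (y : BIdx ι N → Lp ℝ 2 (haarPi ι N)) :
    r • hmk x y = hmk (r • x) (r • y) := rfl

omit [DecidableEq ι] in
/-- The norm in `𝓗` squared, in components. -/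
theorem norm_HSp_sq (z : HSp ι N) : ‖z‖ ^ 2 = ‖z.fst‖ ^ 2 + ∑ a, ‖z.snd a‖ ^ 2 := by
  rw [← real_inner_self_eq_norm_sq, inner_HSp, real_inner_self_eq_norm_sq]
  congr 1
  exact sum_congr rfl fun a _ => real_inner_self_eq_norm_sq _

omit [DecidableEq ι] in
/-- Components are bounded by the norm. -/
theorem norm_fst_le (z : HSp ι N) : ‖z.fst‖ ≤ ‖z‖ := by
  have h := norm_HSp_sq z
  have hs : 0 ≤ ∑ a, ‖z.snd a‖ ^ 2 := sum_nonneg fun a _ => sq_nonneg _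
  nlinarith [norm_nonneg z, norm_nonneg z.fst]

omit [DecidableEq ι] in
/-- The gradient components of `z ∈ 𝓗` have total square norm at most `‖z‖²`. -/
theorem sum_norm_snd_sq_le (z : HSp ι N) : ∑ a, ‖z.snd a‖ ^ 2 ≤ ‖z‖ ^ 2 := by
  rw [norm_HSp_sq]; nlinarith [sq_nonneg ‖z.fst‖]

/-- The restriction of a smooth ambient function to `SU(N)^E` as an element of `L²(σ^{⊗E})`. -/
def sL2 (F : Cfg ι N → ℝ) (hF : ContDiff ℝ ∞ F) : Lp ℝ 2 (haarPi ι N) :=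
  toL2 ι N (resCM F (continuous_restrict hF))

/-- `J F = (F, (D_aF)_a) ∈ 𝓗` for a smooth ambient function `F`. -/
def sobJ (F : Cfg ι N → ℝ) (hF : ContDiff ℝ ∞ F) : HSp ι N :=
  hmk (sL2 F hF) fun a => sL2 (algD (bframe a) F) (contDiff_algD hF _)

/-- The function component of `J F` is `F` (as an element of `L²`). -/
@[simp] theorem sobJ_fst (F : Cfg ι N → ℝ) (hF : ContDiff ℝ ∞ F) : (sobJ F hF).fst = sL2 F hF := rfl

/-- The `a`-th gradient component of `J F` is `D_a F` (as an element of `L²`). -/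
@[simp] theorem sobJ_snd_apply (F : Cfg ι N → ℝ) (hF : ContDiff ℝ ∞ F) (a : BIdx ι N) :
    (sobJ F hF).snd a = sL2 (algD (bframe a) F) (contDiff_algD hF _) := rfl

omit [DecidableEq ι] in
/-- The `L²` function underlying `sL2 F` is a.e. `F ∘ emb`. -/
theorem sL2_coeFn {F : Cfg ι N → ℝ} (hF : ContDiff ℝ ∞ F) :
    (fun g => (sL2 F hF) g) =ᵐ[haarPi ι N] fun g => F (emb g) :=
  ContinuousMap.coeFn_toLp (p := 2) (μ := haarPi ι N) (𝕜 := ℝ) (resCM F (continuous_restrict hF))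

omit [DecidableEq ι] in
/-- Inner products of restricted smooth functions are integrals. -/
theorem inner_sL2_sL2 {F G : Cfg ι N → ℝ} (hF : ContDiff ℝ ∞ F) (hG : ContDiff ℝ ∞ G) :
    ⟪sL2 F hF, sL2 G hG⟫_ℝ = ∫ g : PSU ι N, F (emb g) * G (emb g) ∂(haarPi ι N) := by
  rw [sL2, sL2, inner_toL2_toL2]; rfl

omit [DecidableEq ι] in
/-- Inner product of a restricted smooth function with an element of `L²`. -/
theorem inner_sL2_left {F : Cfg ι N → ℝ} (hF : ContDiff ℝ ∞ F) (x : Lp ℝ 2 (haarPi ι N)) :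
    ⟪sL2 F hF, x⟫_ℝ = ∫ g : PSU ι N, F (emb g) * x g ∂(haarPi ι N) := by
  rw [sL2, inner_toL2_left]; rfl

omit [DecidableEq ι] in
/-- `sL2` is additive. -/
theorem sL2_add {F G : Cfg ι N → ℝ} (hF : ContDiff ℝ ∞ F) (hG : ContDiff ℝ ∞ G) :
    sL2 (F + G) (hF.add hG) = sL2 F hF + sL2 G hG := by
  rw [sL2, sL2, sL2, ← map_add]; rfl

omit [DecidableEq ι] in
/-- `sL2` is compatible with subtraction. -/
theorem sL2_sub {F G : Cfg ι N → ℝ} (hF : ContDiff ℝ ∞ F) (hG : ContDiff ℝ ∞ G) :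
    sL2 (F - G) (hF.sub hG) = sL2 F hF - sL2 G hG := by
  rw [sL2, sL2, sL2, ← map_sub]; rfl

omit [DecidableEq ι] in
/-- `sL2` is compatible with scalar multiplication. -/
theorem sL2_smul (r : ℝ) {F : Cfg ι N → ℝ} (hF : ContDiff ℝ ∞ F) :
    sL2 (r • F) (hF.const_smul r) = r • sL2 F hF := by
  rw [sL2, sL2, ← map_smul]; rfl

omit [DecidableEq ι] in
/-- `sL2` only depends on the function (proof irrelevance helper). -/
theorem sL2_congr {F G : Cfg ι N → ℝ} (hF : ContDiff ℝ ∞ F) (hG : ContDiff ℝ ∞ G) (h : F = G) :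
    sL2 F hF = sL2 G hG := by subst h; rfl

omit [DecidableEq ι] in
/-- `‖sL2 F - x‖² = ∫ (F - x)²`. -/
theorem norm_sL2_sub_sq {F : Cfg ι N → ℝ} (hF : ContDiff ℝ ∞ F) (x : Lp ℝ 2 (haarPi ι N)) :
    ‖sL2 F hF - x‖ ^ 2 = ∫ g : PSU ι N, (F (emb g) - x g) ^ 2 ∂(haarPi ι N) := by
  rw [sL2, norm_toL2_sub_sq]; rfl

omit [DecidableEq ι] in
/-- `‖F‖²_{L²} = ∫ F²`. -/
theorem norm_sL2_sq {F : Cfg ι N → ℝ} (hF : ContDiff ℝ ∞ F) :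
    ‖sL2 F hF‖ ^ 2 = ∫ g : PSU ι N, F (emb g) ^ 2 ∂(haarPi ι N) := by
  rw [sL2, norm_toL2_sq]; rfl

omit [DecidableEq ι] in
/-- `‖F - G‖²_{L²} = ∫ (F - G)²`. -/
theorem norm_sL2_sub_sL2_sq {F G : Cfg ι N → ℝ} (hF : ContDiff ℝ ∞ F) (hG : ContDiff ℝ ∞ G) :
    ‖sL2 F hF - sL2 G hG‖ ^ 2 = ∫ g : PSU ι N, (F (emb g) - G (emb g)) ^ 2 ∂(haarPi ι N) := by
  rw [sL2, sL2, norm_toL2_sub_toL2_sq]; rfl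

/-- `J` is additive. -/
theorem sobJ_add {F G : Cfg ι N → ℝ} (hF : ContDiff ℝ ∞ F) (hG : ContDiff ℝ ∞ G) :
    sobJ (F + G) (hF.add hG) = sobJ F hF + sobJ G hG := by
  rw [sobJ, sobJ, sobJ, hmk_add]
  have h1 : sL2 (F + G) (hF.add hG) = sL2 F hF + sL2 G hG := sL2_add hF hG
  have h2 : (fun a => sL2 (algD (bframe a) (F + G)) (contDiff_algD (hF.add hG) _)) =
      (fun a => sL2 (algD (bframe a) F) (contDiff_algD hF _)) + fun a => sL2 (algD (bframe a) G) (contDiff_algD hG _) := by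
    funext a
    rw [Pi.add_apply, ← sL2_add]
    exact sL2_congr _ _ (algD_add hF hG _)
  rw [h1, h2]

/-- `J` is homogeneous. -/
theorem sobJ_smul (r : ℝ) {F : Cfg ι N → ℝ} (hF : ContDiff ℝ ∞ F) :
    sobJ (r • F) (hF.const_smul r) = r • sobJ F hF := by
  rw [sobJ, sobJ, hmk_smul]
  have h1 : sL2 (r • F) (hF.const_smul r) = r • sL2 F hF := sL2_smul r hF
  have h2 : (fun a => sL2 (algD (bframe a) (r • F)) (contDiff_algD (hF.const_smul r) _)) =
      r • fun a => sL2 (algD (bframe a) F) (contDiff_algD hF _) := by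
    funext a
    rw [Pi.smul_apply, ← sL2_smul]
    refine sL2_congr _ _ ?_
    have : r • F = fun Q => r * F Q := rfl
    rw [this, algD_const_mul hF]
    rfl
  rw [h1, h2]

/-- `J` respects subtraction. -/
theorem sobJ_sub {F G : Cfg ι N → ℝ} (hF : ContDiff ℝ ∞ F) (hG : ContDiff ℝ ∞ G) :
    sobJ (F - G) (hF.sub hG) = sobJ F hF - sobJ G hG := by
  rw [sobJ, sobJ, sobJ, hmk_sub]
  have h1 : sL2 (F - G) (hF.sub hG) = sL2 F hF - sL2 G hG := sL2_sub hF hG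
  have h2 : (fun a => sL2 (algD (bframe a) (F - G)) (contDiff_algD (hF.sub hG) _)) =
      (fun a => sL2 (algD (bframe a) F) (contDiff_algD hF _)) - fun a => sL2 (algD (bframe a) G) (contDiff_algD hG _) := by
    funext a
    rw [Pi.sub_apply, ← sL2_sub]
    exact sL2_congr _ _ (algD_sub hF hG _)
  rw [h1, h2]

/-- **`⟪J F, J G⟫ = ∫ FG + ∫ Γ(F,G)`.** -/
theorem inner_sobJ_sobJ {F G : Cfg ι N → ℝ} (hF : ContDiff ℝ ∞ F) (hG : ContDiff ℝ ∞ G) :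
    ⟪sobJ F hF, sobJ G hG⟫_ℝ = ∫ g : PSU ι N, F (emb g) * G (emb g) ∂(haarPi ι N) +
      ∫ g : PSU ι N, Gam F G (emb g) ∂(haarPi ι N) := by
  rw [inner_HSp, sobJ_fst, sobJ_fst, inner_sL2_sL2]
  congr 1
  simp only [sobJ_snd_apply, inner_sL2_sL2]
  have hi : ∀ a : BIdx ι N, Integrable (fun g : PSU ι N => algD (bframe a) F (emb g) * algD (bframe a) G (emb g))
      (haarPi ι N) := fun a =>
    integrable_of_continuous_PSU ((continuous_restrict (contDiff_algD hF _)).mul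
      (continuous_restrict (contDiff_algD hG _))) _
  rw [← integral_finsetSum _ fun a _ => hi a]
  rfl

/-- `⟪J F, z⟫ = ∫ F ψ + ∑_a ∫ D_aF ζ_a` for `z = (ψ, ζ)`. -/
theorem inner_sobJ_left {F : Cfg ι N → ℝ} (hF : ContDiff ℝ ∞ F) (z : HSp ι N) :
    ⟪sobJ F hF, z⟫_ℝ = ∫ g : PSU ι N, F (emb g) * z.fst g ∂(haarPi ι N) +
      ∑ a, ∫ g : PSU ι N, algD (bframe a) F (emb g) * z.snd a g ∂(haarPi ι N) := by
  rw [inner_HSp, sobJ_fst, inner_sL2_left]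
  congr 1
  exact sum_congr rfl fun a _ => by rw [sobJ_snd_apply, inner_sL2_left]

/-- `‖J F - J G‖² = ∫ (F-G)² + ∫ Γ(F-G, F-G)`. -/
theorem norm_sobJ_sub_sq {F G : Cfg ι N → ℝ} (hF : ContDiff ℝ ∞ F) (hG : ContDiff ℝ ∞ G) :
    ‖sobJ F hF - sobJ G hG‖ ^ 2 = ∫ g : PSU ι N, (F (emb g) - G (emb g)) ^ 2 ∂(haarPi ι N) +
      ∫ g : PSU ι N, Gam (F - G) (F - G) (emb g) ∂(haarPi ι N) := by
  rw [← sobJ_sub hF hG, ← real_inner_self_eq_norm_sq, inner_sobJ_sobJ]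
  congr 1
  exact integral_congr_ae (ae_of_all _ fun g => by simp only [Pi.sub_apply]; ring)

/-! ### The polynomial Sobolev subspaces and `H¹` -/

/-- `J` on `𝒫_n` as a linear map. -/
def sobPoly (n : ℕ) : polySpace ι N n →ₗ[ℝ] HSp ι N where
  toFun p := sobJ p.1 (contDiff_of_mem_polySpace p.2)
  map_add' p q := sobJ_add (contDiff_of_mem_polySpace p.2) (contDiff_of_mem_polySpace q.2)
  map_smul' r p := sobJ_smul r (contDiff_of_mem_polySpace p.2)

/-- `sobPoly n p = J p`. -/
@[simp] theorem sobPoly_apply {n : ℕ} (p : polySpace ι N n) :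
    sobPoly n p = sobJ p.1 (contDiff_of_mem_polySpace p.2) := rfl

variable (ι N) in
/-- `J(𝒫_n) ⊂ 𝓗`. -/
def VSob (n : ℕ) : Submodule ℝ (HSp ι N) := LinearMap.range (sobPoly (ι := ι) (N := N) n)

/-- `VSob` is monotone in the degree. -/
theorem monotone_VSob : Monotone (VSob ι N) := by
  intro n n' h x hx
  obtain ⟨p, rfl⟩ := hx
  exact ⟨⟨p.1, polySpace_mono h p.2⟩, rfl⟩

variable (ι N) in
/-- **`H¹(σ^{⊗E})`**: the closure of `J(𝒫)` in `𝓗`. -/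
def HOne : Submodule ℝ (HSp ι N) := (⨆ n, VSob ι N n).topologicalClosure

/-- `H¹` is closed. -/
theorem isClosed_HOne : IsClosed (HOne ι N : Set (HSp ι N)) := Submodule.isClosed_topologicalClosure _

/-- `H¹` is complete (a closed subspace of a Hilbert space). -/
instance HOne.completeSpace : CompleteSpace (HOne ι N) := (isClosed_HOne (ι := ι) (N := N)).completeSpace_coe

/-- `H¹` admits an orthogonal projection. -/
instance HOne.hasOrthogonalProjection : (HOne ι N).HasOrthogonalProjection :=
  Submodule.HasOrthogonalProjection.ofCompleteSpace _

/-- `J p ∈ H¹` for a polynomial `p`. -/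
theorem sobJ_mem_HOne_of_mem_polySpace {n : ℕ} {p : Cfg ι N → ℝ} (hp : p ∈ polySpace ι N n) :
    sobJ p (contDiff_of_mem_polySpace hp) ∈ HOne ι N :=
  Submodule.le_topologicalClosure _ ((le_iSup (VSob ι N) n) ⟨⟨p, hp⟩, rfl⟩)

end SharpClustering

end Summit.Ventures.YMGap
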